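import Summits.BirchSwinnertonDyer.Rank1Residual.X11b.BDPRouteUpperLinks
import Summits.BirchSwinnertonDyer.Rank1Residual.X11b.Three.TamagawaTwistAnyDiscr
import HarnessLib

/-!
# Crux `EulerHalvesAtThree` (item stmt-BirchSwinnertonDyer-19109; routes `ClassRecordThree` ∕ `KolyvaginRoadThree`):
# the JSW §7.4.2 bookkeeping WITH A SAVING — the valuation core and the numeric Tamagawa condition with ONE
# carrier place outside the inert set (cell `bsd-stepL`, seat `bsd-stepL-tam3-p1` g11, LINE OWNER of 19109;
# `--supports stmt-BirchSwinnertonDyer-19109 --as helper`)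

HONEST FRAMING: TWO THEOREMS (no definition, no named fact, no `sorry`); pure valuation bookkeeping, CONDITIONAL
on every displayed binder; nothing here is a statement about CM points, Selmer groups or any particular curve;
no census label moves (T7); item 19109 is NOT closed by this file. BSD is not proved by any of this.

WHY (the «Jetchev-MAX on `X_{N⁺,N⁻}`» cut of 19109's IMC-grade residual, tam3-p1 g9's census memo
`HOME/tam3-p1/skeleton-19109-inert/INERT-CUT-CENSUS-g9.md` §Reading): on the registered line `Lines/inert.lean`
the carrier-inert Shimura road (`Theorems/ClassRecordThreeEulerHalvesAtThreeShimuraInert.lean`, p550099) pays the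
Tamagawa factors of the primes put into `N⁻` by the Ribet–Takahashi degree drop and needs EVERY prime `q` with
`3 ∣ c_q(E)` inside the inert set `S` (its SHAPE binder: such a `q` is split multiplicative). The 178 residual
TRUE-OPEN frames of the crux are exactly the (α)∧ram curves with ONE additive (T2γ) place `q₁` (`c_{q₁} = 3`),
which cannot enter `N⁻`; there the Kolyvagin side must SAVE the factor `c_{q₁}(E)·c_{q₁}(E^{d_K}) = c_{q₁}(E)²`
(`q₁` splits in `K`) — Jetchev's global divisibility `p^{ord_p c_{q₁}} ∣ [E(K):ℤP]` read on the Shimura-curve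
Heegner point, i.e. the order bound `ord_p #Ш(E/K)[p^∞] + 2s ≤ 2·ord_p [E(K):ℤP]` with `s = ord_p c_{q₁}(E)`
(McCallum 1991 Cor. 5.6 ∕ Jetchev 2008 (1) shape). This file is the valuation half of that cut:

* `missingUpperBoundAt_of_shimuraShapes_of_saving` — x11b's `missingUpperBoundAt_of_shimuraShapes`
  (`X11b/BDPRouteUpperLinks.lean`, JSW §7.4.2 p. 31) with (U-Sh) replaced by the SAVED order bound
  `ord_p #Ш(E/K)[p^∞] + 2s ≤ 2·ord_p[E(K):ℤP]` and the numeric Tamagawa condition relaxed to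
  `ord_p ∏c(E) + ord_p ∏c(E^{d_K}) ≤ T + 2s`; same arithmetic, same conclusion `Typed.MissingUpperBoundAt W p`.
* `padicValNat_tamagawaProduct_add_twist_le_of_inertSet'_binder_of_extraPlace` — x11b3's
  `padicValNat_tamagawaProduct_add_twist_le_of_inertSet'_binder` (`X11b/Three/TamagawaTwistAnyDiscr.lean`) with ONE
  bad prime `q₁ ∉ S` (split in `K`) EXEMPTED from the SHAPE ∕ très-ramifié binders: the conclusion picks up
  exactly `2·ord_p c_{q₁}(E)` (`c_{q₁}(E^{d_K}) = c_{q₁}(E)`, `localTamagawaNumber_twist_eq_of_isSquare`).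

References: [JetchevSkinnerWan2017] §7.4.2 (p. 31), §7.3.1; [Jetchev2008] Thm. 1.1, (1) (p. 812); [McCallumLMS1991]
Cor. 5.6; [Kim2022HigherGZ] Rem. 7.9 (arXiv:2203.12161 p. 18: «p does not divide any Tamagawa factor at a prime
dividing N⁺ thanks to the work of Jetchev», the `X_{N⁺,N⁻}` reading); [SilvermanAEC2009] VII.6 Ex. 7.6;
[SilvermanATAEC1994] IV.9.4; [Miller2011LMS] Def. 1.1.
-/

noncomputable section

open scoped Classical

open WeierstrassCurve NumberField IsDedekindDomain IsDedekindDomain.HeightOneSpectrum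
  Literature.NumberTheory.EllipticCurves Rat.HeightOneSpectrum
  Literature.NumberTheory.EllipticCurves.ModularForms
  Literature.NumberTheory.EllipticCurves.Rank1Residual
  Literature.NumberTheory.EllipticCurves.Rank1Residual.Typed
  Literature.NumberTheory.DiophantineGeometry
  Summit.BirchSwinnertonDyer.Rank1Residual Summit.BirchSwinnertonDyer.Rank1Residual.X11b

-- the cell's Theorems namespace repeats the summit name (Summit.<Summit>.<Problem>), as in every sibling file
set_option linter.dupNamespace false

namespace Summit.BirchSwinnertonDyer.BirchSwinnertonDyer.Theorems

/-! ### §1. The bookkeeping core WITH A SAVING `2s` on the Kolyvagin side -/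

/-- **The Euler-system half of `BSD(E,p)` from the two Shimura-curve links of Jetchev–Skinner–Wan §7.4.2 WITH A
SAVING.** Data as in x11b's `missingUpperBoundAt_of_shimuraShapes` (`W/ℚ` elliptic, `p` odd, `K` ANY quadratic
field, `Wd` any model of `E^{d_K}`, both `Ш` finite, `P ∈ E(K)` any point, the `N⁻`-term `T : ℕ`) plus a saving
`s : ℕ`. Hypotheses: the SAVED order bound `ord_p #Ш(E/K)[p^∞] + 2s ≤ 2·ord_p [E(K):ℤP]` (McCallum 1991 Cor. 5.6 ∕
Jetchev 2008 (1) shape: the Kolyvagin system is globally `p^s`-divisible); (GZ-Sh) `2·ord_p[E(K):ℤP] + T =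
ord_p q_E + ord_p q_d`; the twist's `≥`-half (Skinner 2016 Thm. C shape); and the numeric Tamagawa condition
RELAXED by the saving, `ord_p ∏c(E) + ord_p ∏c(E^{d_K}) ≤ T + 2s`. CONCLUSION: `Typed.MissingUpperBoundAt W p`.
Arithmetic: `v(Ш_E) + v(Ш_d) + 2s = v(#Ш(E/K)[p^∞]) + 2s ≤ 2v(I) = v(q_E) + v(q_d) − T ≤ v(q_E) + v(Ш_d) + v(c_d) − T
≤ v(q_E) + v(Ш_d) − v(c_E) + 2s`. CONDITIONAL on the shapes; nothing booked.
[cite: JetchevSkinnerWan2017, §7.4.2 (p. 31) and Thm. 4.4.1 (p. 19)] [cite: Jetchev2008, Thm. 1.1 and (1) (p. 812)]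
[cite: McCallumLMS1991, Cor. 5.6] [cite: Miller2011LMS, Def. 1.1 (arXiv:1010.2431 p. 3)] -/
theorem missingUpperBoundAt_of_shimuraShapes_of_saving
    (W : WeierstrassCurve ℚ) [W.IsElliptic] (p : ℕ) [Fact p.Prime] (hp2 : p ≠ 2)
    (K : Type) [Field K] [NumberField K] (h2 : Module.finrank ℚ K = 2)
    (Wd : WeierstrassCurve ℚ) [Wd.IsElliptic]
    (hWd : ∃ C : VariableChange ℚ, C • W.quadraticTwist (NumberField.discr K : ℚ) = Wd)
    (hfinW : W.ShaFinite) (hfinD : Wd.ShaFinite)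
    (P : (W.baseChange K).toAffine.Point) (T s : ℕ)
    -- the numeric Tamagawa condition RELAXED by the saving
    (hT : padicValNat p W.tamagawaProduct + padicValNat p Wd.tamagawaProduct ≤ T + 2 * s)
    -- the `≥`-half of the rank-zero `p`-part for the twist (Skinner 2016 Thm. C shape)
    (htw : ∃ q : ℚ, Wd.entireLFunction 1 / (Wd.realPeriodRat : ℂ) = (q : ℂ) ∧
      padicValRat p q ≤ (padicValNat p Wd.shaOrder : ℤ) + padicValNat p Wd.tamagawaProduct -
        2 * padicValNat p Wd.torsionOrder)
    -- (GZ-Sh): the Gross–Zagier formula on `X_{N⁺,N⁻}` in BSD normalisation, with `N⁻`-term `T`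
    (hGZSh : ∃ qE qd : ℚ, qE ≠ 0 ∧ qd ≠ 0 ∧
      W.leadingLCoeff / ((W.realPeriodRat : ℂ) * (W.regulator : ℂ)) = (qE : ℂ) ∧
      Wd.entireLFunction 1 / (Wd.realPeriodRat : ℂ) = (qd : ℂ) ∧
      (2 * padicValNat p (AddSubgroup.zmultiples P).index : ℤ) + T =
        padicValRat p qE + padicValRat p qd)
    -- the SAVED order bound (McCallum Cor. 5.6 ∕ Jetchev (1) shape on the Shimura-curve Heegner point)
    (hUShs : padicValNat p (Nat.card (AddCommGroup.primaryComponent (W.baseChange K).sha p)) + 2 * s ≤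
      2 * padicValNat p (AddSubgroup.zmultiples P).index) :
    Typed.MissingUpperBoundAt W p := by
  have hp : p.Prime := Fact.out
  haveI : (W.baseChange K).IsElliptic := inferInstanceAs (W.map (algebraMap ℚ K)).IsElliptic
  haveI : Finite W.sha := hfinW
  haveI : Finite Wd.sha := hfinD
  haveI : Finite (AddCommGroup.primaryComponent W.sha p) :=
    Finite.of_injective _ Subtype.val_injective
  haveI : Finite (AddCommGroup.primaryComponent Wd.sha p) :=
    Finite.of_injective _ Subtype.val_injective
  ---------------------------------------------------------------- `Ш(E/K)[p^∞] = Ш(E)[p^∞] ⊕ Ш(E^d)[p^∞]`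
  have hprod := card_primaryComponent_sha_baseChange_quadratic_of_odd_of_finite W K h2 Wd hWd
    (W.baseChange K) ⟨1, one_smul _ _⟩ p hp2
  rw [card_addPrimaryComponent_eq_pow (A := ↥W.sha) p, card_addPrimaryComponent_eq_pow (A := ↥Wd.sha) p,
    ← pow_add, Nat.factorization_def _ hp, Nat.factorization_def _ hp] at hprod
  rw [hprod, padicValNat.prime_pow] at hUShs
  have e1 : padicValNat p (Nat.card W.sha) + padicValNat p (Nat.card Wd.sha) + 2 * s ≤
      2 * padicValNat p (AddSubgroup.zmultiples P).index := hUShs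
  ---------------------------------------------------------------- the rational numbers
  obtain ⟨qd', hqd', hvqd⟩ := htw
  obtain ⟨qE, qd, hqE0, hqd0, hqE, hqd, hGZ⟩ := hGZSh
  have hqq : qd' = qd := by exact_mod_cast hqd'.symm.trans hqd
  subst hqq
  ---------------------------------------------------------------- `#Ш(E)_an = q_E · t_E² / c_E`
  have hΩ : 0 < W.realPeriodRat := W.realPeriodRat_pos_holds
  have hR : 0 < W.regulator := W.regulator_pos'
  have hcW : 0 < W.tamagawaProduct := W.tamagawaProduct_pos_holds
  have htW : 0 < W.torsionOrder := W.torsionOrder_pos_holds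
  have hΩC : (W.realPeriodRat : ℂ) ≠ 0 := by exact_mod_cast hΩ.ne'
  have hRC : (W.regulator : ℂ) ≠ 0 := by exact_mod_cast hR.ne'
  have hcC : (W.tamagawaProduct : ℂ) ≠ 0 := by exact_mod_cast hcW.ne'
  have hlead : W.leadingLCoeff = (qE : ℂ) * (W.realPeriodRat : ℂ) * (W.regulator : ℂ) := by
    have := (div_eq_iff (mul_ne_zero hΩC hRC)).mp hqE
    rw [this]; ring
  set q : ℚ := qE * (W.torsionOrder : ℚ) ^ 2 / (W.tamagawaProduct : ℚ) with hq_def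
  have hsha : shaAn W = (q : ℂ) := by
    rw [shaAn_def, hlead, hq_def]
    push_cast
    field_simp
  refine ⟨q, hsha, ?_⟩
  ---------------------------------------------------------------- valuations
  have htq : (W.torsionOrder : ℚ) ≠ 0 := by exact_mod_cast htW.ne'
  have hcq : (W.tamagawaProduct : ℚ) ≠ 0 := by exact_mod_cast hcW.ne'
  have hvq : padicValRat p q = padicValRat p qE + 2 * padicValNat p W.torsionOrder -
      padicValNat p W.tamagawaProduct := by
    rw [hq_def, padicValRat.div (mul_ne_zero hqE0 (pow_ne_zero 2 htq)) hcq,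
      padicValRat.mul hqE0 (pow_ne_zero 2 htq), padicValRat.pow, padicValRat.of_nat,
      padicValRat.of_nat]
    push_cast; ring
  have e1' : (padicValNat p W.shaOrder : ℤ) + padicValNat p Wd.shaOrder + 2 * s ≤
      2 * padicValNat p (AddSubgroup.zmultiples P).index := by
    unfold WeierstrassCurve.shaOrder; exact_mod_cast e1
  have e4 : (padicValNat p W.tamagawaProduct : ℤ) + padicValNat p Wd.tamagawaProduct ≤ T + 2 * s := by
    exact_mod_cast hT
  have e5 : (0 : ℤ) ≤ padicValNat p Wd.torsionOrder := by exact_mod_cast Nat.zero_le _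
  have e6 : (0 : ℤ) ≤ padicValNat p W.torsionOrder := by exact_mod_cast Nat.zero_le _
  rw [hvq]
  omega

/-! ### §2. The numeric Tamagawa condition with ONE carrier place outside the inert set -/

/-- `ord_p` of a finite product of non-zero naturals is the sum of the `ord_p`. [folklore] -/
private theorem padicValNat_finset_prod_saving (p : ℕ) [Fact p.Prime] {ι : Type*} (s : Finset ι)
    (f : ι → ℕ) (hf : ∀ i ∈ s, f i ≠ 0) :
    padicValNat p (∏ i ∈ s, f i) = ∑ i ∈ s, padicValNat p (f i) := by
  induction s using Finset.induction_on with
  | empty => simp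
  | insert a s ha ih =>
    rw [Finset.prod_insert ha, Finset.sum_insert ha,
      padicValNat.mul (hf a (Finset.mem_insert_self a s))
        (Finset.prod_ne_zero_iff.mpr fun i hi => hf i (Finset.mem_insert_of_mem hi)),
      ih fun i hi => hf i (Finset.mem_insert_of_mem hi)]

/-- **The numeric Tamagawa condition of JSW §7.4.2 at every ODD `p`, ANY `d_K`, modulo the binder at `2`, WITH ONE
CARRIER PLACE OUTSIDE THE INERT SET.** As x11b3's `padicValNat_tamagawaProduct_add_twist_le_of_inertSet'_binder`
(`S` a set of multiplicative primes inert in `K`, every other bad prime split, every ODD good `q ∣ d_K` `≥ 5` or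
`p ≥ 5`, the binder at `2`), except that ONE bad prime `q₁ ∉ S` is EXEMPTED from the Tamagawa SHAPE («`p ∣ c_q(E)` ⇒
split multiplicative») and from the très-ramifié condition («split multiplicative `ℓ ∉ S` ⇒ `p ∤ ord_ℓ Δ_min`»):
then `ord_p ∏c(E) + ord_p ∏c(E^{d_K}) ≤ Σ_{ℓ∈S} ord_p(ord_ℓ Δ_min(E)) + 2·ord_p c_{q₁}(E)` — at the split place `q₁`
the twist has the same local Tamagawa number (`localTamagawaNumber_twist_eq_of_isSquare`), so the exempted place
costs exactly `2·ord_p c_{q₁}(E)`, the amount Jetchev's divisibility saves. The intended `q₁` is the (T2γ) prime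
of a residual frame of crux 19109 (additive, Kodaira `IV`∕`IV*`, `c_{q₁} = 3`), but nothing about `q₁` beyond «bad,
outside `S`» is used. [cite: JetchevSkinnerWan2017, §7.4.2 (p. 31) and §7.3.1 (eq:tamK)]
[cite: SilvermanAEC2009, VII.6 Ex. 7.6] [cite: SilvermanATAEC1994, IV.9.4 Steps 2, 6 and Cor. IV.9.2(d)] -/
theorem padicValNat_tamagawaProduct_add_twist_le_of_inertSet'_binder_of_extraPlace
    (W : WeierstrassCurve ℚ) [W.IsElliptic] [W.IsGloballyMinimal] (p : ℕ) [Fact p.Prime]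
    (hp2 : p ≠ 2) (K : Type) [Field K] [NumberField K] (h2 : Module.finrank ℚ K = 2)
    (h5 : ∀ (q : ℕ) [Fact q.Prime], (q : ℤ) ∣ NumberField.discr K → W.HasGoodReductionAtPrime q →
      q ≠ 2 → 5 ≤ q ∨ 5 ≤ p)
    -- the exempted place: a bad prime outside `S`
    (q₁ : ℕ) [Fact q₁.Prime] (hbad₁ : ¬ W.HasGoodReductionAtPrime q₁)
    (hshape : ∀ (q : ℕ) [Fact q.Prime], q ≠ q₁ → p ∣ (W.baseChange ℚ_[q]).localTamagawaNumber ℤ_[q] →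
      W.HasSplitMultiplicativeReductionAtPrime q)
    {Wd : WeierstrassCurve ℚ} [Wd.IsElliptic] [Wd.IsGloballyMinimal] (Cd : VariableChange ℚ)
    (hWd : Cd • W.quadraticTwist (NumberField.discr K : ℚ) = Wd)
    -- THE binder at `2`
    (hbind : (2 : ℤ) ∣ NumberField.discr K → W.HasGoodReductionAtPrime 2 →
      ¬ p ∣ (Wd.baseChange ℚ_[2]).localTamagawaNumber ℤ_[2])
    (S : Finset ℕ) (hq₁S : q₁ ∉ S)
    (hS : ∀ ℓ ∈ S, ∃ _ : Fact ℓ.Prime, Mult W ℓ ∧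
      ((ℓ ≠ 2 ∧ jacobiSym (NumberField.discr K) ℓ = -1) ∨ (ℓ = 2 ∧ NumberField.discr K % 8 = 5)))
    (hsplit : ∀ (ℓ : ℕ) [Fact ℓ.Prime], ¬ W.HasGoodReductionAtPrime ℓ → ℓ ∉ S →
      IsSquare (algebraMap ℚ ℚ_[ℓ] (NumberField.discr K : ℚ)))
    (hFC : ∀ (ℓ : ℕ) [Fact ℓ.Prime], ℓ ∉ S → ℓ ≠ q₁ → W.HasSplitMultiplicativeReductionAtPrime ℓ →
      ¬ p ∣ padicValInt ℓ W.minimalDiscriminantInt) :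
    padicValNat p W.tamagawaProduct + padicValNat p Wd.tamagawaProduct ≤
      (∑ ℓ ∈ S, padicValNat p (padicValInt ℓ W.minimalDiscriminantInt)) +
        2 * padicValNat p ((W.baseChange ℚ_[q₁]).localTamagawaNumber ℤ_[q₁]) := by
  have hp : p.Prime := Fact.out
  have hfW : (W.badPlaces ℤ).Finite := W.finite_badPlaces_holds ℤ
  have hfWd : (Wd.badPlaces ℤ).Finite := Wd.finite_badPlaces_holds ℤ
  set s : Finset (HeightOneSpectrum ℤ) := hfW.toFinset ∪ hfWd.toFinset with hs
  have hsW : ∀ v, ¬ W.HasGoodReductionAt v → v ∈ s := fun v hv ↦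
    Finset.mem_union_left _ (by rw [Set.Finite.mem_toFinset, mem_badPlaces_iff]; exact hv)
  have hsWd : ∀ v, ¬ Wd.HasGoodReductionAt v → v ∈ s := fun v hv ↦
    Finset.mem_union_right _ (by rw [Set.Finite.mem_toFinset, mem_badPlaces_iff]; exact hv)
  set f : HeightOneSpectrum ℤ → ℕ := fun v ↦
    haveI := Fact.mk (primesEquiv v).2
    padicValNat p ((W.baseChange ℚ_[primesEquiv v]).localTamagawaNumber ℤ_[primesEquiv v]) +
      padicValNat p ((Wd.baseChange ℚ_[primesEquiv v]).localTamagawaNumber ℤ_[primesEquiv v]) with hf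
  set g : ℕ → ℕ := fun ℓ ↦ padicValNat p (padicValInt ℓ W.minimalDiscriminantInt) with hg
  -- the bound at the exempted place
  set b₁ : ℕ := 2 * padicValNat p ((W.baseChange ℚ_[q₁]).localTamagawaNumber ℤ_[q₁]) with hb₁
  have hterm : ∀ v : HeightOneSpectrum ℤ,
      f v ≤ if (primesEquiv v : ℕ) ∈ S then g (primesEquiv v : ℕ) else
        if (primesEquiv v : ℕ) = q₁ then b₁ else 0 := by
    intro v
    haveI := Fact.mk (primesEquiv v).2
    have key : ∀ (q : ℕ) (hq : Fact q.Prime), (primesEquiv v : ℕ) = q →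
        padicValNat p (@WeierstrassCurve.localTamagawaNumber ℤ_[q] _ _ _ ℚ_[q] _ _ _ (W.baseChange ℚ_[q])) +
          padicValNat p (@WeierstrassCurve.localTamagawaNumber ℤ_[q] _ _ _ ℚ_[q] _ _ _ (Wd.baseChange ℚ_[q])) ≤
          if q ∈ S then g q else if q = q₁ then b₁ else 0 := by
      rintro q hq hvq
      by_cases hqS : q ∈ S
      · obtain ⟨_, hmult, hcase⟩ := hS q hqS
        rw [if_pos hqS, hg]
        rcases hcase with ⟨hq2, hJ⟩ | ⟨rfl, h8⟩
        · exact padicValNat_localTamagawaNumber_add_twist_le_of_inert_odd W K Cd hWd q hq2 hJ p hp2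
            hmult
        · exact padicValNat_localTamagawaNumber_add_twist_le_of_inert_two_odd W K Cd hWd h8 p hp2
            hmult
      · rw [if_neg hqS]
        by_cases hq1 : q = q₁
        · -- the exempted place: `c_{q₁}(E^{d_K}) = c_{q₁}(E)` (split in `K`)
          subst hq1
          rw [if_pos rfl, hb₁]
          haveI : (W.baseChange ℚ_[q]).IsElliptic := inferInstanceAs (W.map (algebraMap ℚ ℚ_[q])).IsElliptic
          rw [localTamagawaNumber_twist_eq_of_isSquare W K Cd hWd q (hsplit q hbad₁ hqS), two_mul]
        · rw [if_neg hq1, Nat.le_zero]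
          by_cases hgood : W.HasGoodReductionAtPrime q
          · refine padicValNat_localTamagawaNumber_add_twist_eq_zero_of_good_binder W K Cd hWd q p hp2
              h2 (fun hqd hq2 ↦ h5 q hqd hgood hq2) ?_ hgood
            rintro hqd rfl
            exact hbind hqd hgood
          · exact padicValNat_localTamagawaNumber_add_twist_eq_zero_of_isSquare_of_shape W K Cd hWd q p
              (hsplit q hgood hqS) (hshape q hq1) (hFC q hqS hq1)
    exact key _ _ rfl
  rw [tamagawaProduct_eq_prod W s hsW, tamagawaProduct_eq_prod Wd s hsWd,
    padicValNat_finset_prod_saving p s _ fun v _ ↦ ?_,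
    padicValNat_finset_prod_saving p s _ fun v _ ↦ ?_, ← Finset.sum_add_distrib]
  · calc ∑ v ∈ s, f v
        ≤ ∑ v ∈ s, (if (primesEquiv v : ℕ) ∈ S then g (primesEquiv v : ℕ) else
            if (primesEquiv v : ℕ) = q₁ then b₁ else 0) :=
          Finset.sum_le_sum fun v _ ↦ hterm v
      _ = ∑ ℓ ∈ s.image (fun v ↦ (primesEquiv v : ℕ)), (if ℓ ∈ S then g ℓ else if ℓ = q₁ then b₁ else 0) := by
          rw [Finset.sum_image]
          intro v _ w _ h
          exact primesEquiv.injective (Subtype.ext h)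
      _ ≤ ∑ ℓ ∈ s.image (fun v ↦ (primesEquiv v : ℕ)),
            ((if ℓ ∈ S then g ℓ else 0) + (if ℓ = q₁ then b₁ else 0)) := by
          refine Finset.sum_le_sum fun ℓ _ ↦ ?_
          by_cases hℓS : ℓ ∈ S
          · rw [if_pos hℓS, if_pos hℓS]
            exact Nat.le_add_right _ _
          · rw [if_neg hℓS, if_neg hℓS, zero_add]
      _ = (∑ ℓ ∈ s.image (fun v ↦ (primesEquiv v : ℕ)), (if ℓ ∈ S then g ℓ else 0)) +
            ∑ ℓ ∈ s.image (fun v ↦ (primesEquiv v : ℕ)), (if ℓ = q₁ then b₁ else 0) :=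
          Finset.sum_add_distrib
      _ ≤ (∑ ℓ ∈ S, g ℓ) + b₁ := by
          refine Nat.add_le_add ?_ ?_
          · rw [← Finset.sum_filter]
            exact Finset.sum_le_sum_of_subset_of_nonneg (fun ℓ hℓ ↦ (Finset.mem_filter.mp hℓ).2)
              fun _ _ _ ↦ Nat.zero_le _
          · rw [Finset.sum_ite_eq']
            split_ifs
            · exact le_rfl
            · exact Nat.zero_le _
  · haveI := Fact.mk (primesEquiv v).2
    haveI : (W.baseChange ℚ_[primesEquiv v]).IsElliptic :=
      inferInstanceAs (W.map (algebraMap ℚ ℚ_[primesEquiv v])).IsElliptic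
    exact localTamagawaNumber_padic_ne_zero_holds (primesEquiv v) _
  · haveI := Fact.mk (primesEquiv v).2
    haveI : (Wd.baseChange ℚ_[primesEquiv v]).IsElliptic :=
      inferInstanceAs (Wd.map (algebraMap ℚ ℚ_[primesEquiv v])).IsElliptic
    exact localTamagawaNumber_padic_ne_zero_holds (primesEquiv v) _

end Summit.BirchSwinnertonDyer.BirchSwinnertonDyer.Theorems

end
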